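import Summits.NavierStokesRegularity.NavierStokesRegularity.Theorems.ExtremiserTransienceNearExtremalTransienceSharpConstant
import Literature.Analysis.FluidPDE.AxisymNoSwirlTaoBounds
import Literature.Analysis.FluidPDE.NSLocalLerayFarFieldTrace
import HarnessLib

/-!
# Route `ExtremiserTransience`, support item `KStarAttained` (stmt-NavierStokesRegularity-24370):
# PERTURBATION CALCULUS ON THE ADMISSIBLE CLASS (`v + εφ`, `φ ∈ C^∞_c` divergence free)

`--supports stmt-NavierStokesRegularity-24370`. Author: prover seat `ns-et-p1` (g3).

The item asks whether the sharp depletion constant `κ⋆ = sInf V` (`V` = the universal constants of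
`|∫⟪ω, Dv ω⟫| ≤ κ·M·‖ω‖₂·‖∇ω‖₂` on the admissible class: `C^∞`, divergence free, `|v| ≤ M`, bounded
gradient, `D⁰v, D¹v, D²v ∈ L²`) is ATTAINED. Any variational analysis of an attainer `v` starts by moving
along lines `v + εφ` inside the class; this file is that bookkeeping (no statement about attainment):

* linearity along the line: `fderiv_add_smul`, `curl_add_smul`, `fderiv_curl_add_smul`, `divergence_add_smul`,
  `iteratedFDeriv_add_smul`;
* `admissible_add_smul` — **`v + εφ` is again admissible** (smooth, divergence free, bounded gradient,
  `D⁰, D¹, D² ∈ L²`; the sup bound depends on `φ` and is supplied by the user);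
* `integrable_stretching` — the stretching density `⟪ω, Dv ω⟫` of an admissible field is integrable, and the
  mixed coefficients are integrable (`integrable_stretching_coeffs`, `integrable_enstrophy_coeffs`,
  `integrable_palinstrophy_coeffs`: compact support);
* **the three expansions** `integral_stretching_add_smul` (`J(v+εφ) = J + εJ₁ + ε²J₂ + ε³J₃`),
  `integral_normSq_curl_add_smul` (`Z(v+εφ) = Z + 2εa₁ + ε²a₂`), `integral_frobeniusNormSq_add_smul`
  (`W(v+εφ) = W + 2εc₁ + ε²c₂`), with
  `J₁(φ) = ∫ (⟪curl φ, Dv ω⟫ + ⟪ω, Dφ ω⟫ + ⟪ω, Dv curl φ⟫)`, `a₁(φ) = ∫⟪ω, curl φ⟫`,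
  `c₁(φ) = ∫ Σᵢ ⟪∂ᵢω, ∂ᵢ curl φ⟫` (standard basis `eᵢ`).

Used by `…KStarAttainedVariation.lean` (the Euler–Lagrange identity of an attainer off the contact set).
WHAT THIS IS NOT: nothing here concerns attainment, Navier–Stokes solutions, or regularity; NS regularity is
NOT proved by anything here. [folklore]
-/

noncomputable section

open Set Filter Topology MeasureTheory
open scoped InnerProductSpace RealInnerProductSpace ENNReal NNReal ContDiff
open Literature.Analysis.FluidPDE

namespace Summit.NavierStokesRegularity.NavierStokesRegularity.Theorems

-- the problem directory repeats the summit name (`NavierStokesRegularity/NavierStokesRegularity`)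
set_option linter.dupNamespace false

namespace DepletionLadder.KStar

open Summit.NavierStokesRegularity.NavierStokesRegularity.Theorems.RungReynoldsOne.WeightedSlice

variable {v φ : EuclideanSpace ℝ (Fin 3) → EuclideanSpace ℝ (Fin 3)}

/-! ## Linearity of the objects along the line `v + εφ` -/

/-- `D(v + εφ) = Dv + ε Dφ` for differentiable fields. [folklore] -/
theorem fderiv_add_smul (hv : Differentiable ℝ v) (hφ : Differentiable ℝ φ) (ε : ℝ)
    (x : EuclideanSpace ℝ (Fin 3)) :
    fderiv ℝ (fun y => v y + ε • φ y) x = fderiv ℝ v x + ε • fderiv ℝ φ x := by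
  have h : (fun y => v y + ε • φ y) = v + ε • φ := rfl
  rw [h, ((hv x).hasFDerivAt.add ((hφ x).hasFDerivAt.const_smul ε)).fderiv]

/-- `curl (v + εφ) = curl v + ε curl φ` for differentiable fields. [folklore] -/
theorem curl_add_smul (hv : Differentiable ℝ v) (hφ : Differentiable ℝ φ) (ε : ℝ) :
    curl (fun y => v y + ε • φ y) = fun x => curl v x + ε • curl φ x := by
  funext x
  have hφ' : DifferentiableAt ℝ (fun y => ε • φ y) x := (hφ x).const_smul ε
  rw [curl_add (hv x) hφ', curl_const_smul (hφ x)]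

/-- `D curl (v + εφ) = D curl v + ε D curl φ` for `C²` fields. [folklore] -/
theorem fderiv_curl_add_smul (hv : ContDiff ℝ ∞ v) (hφ : ContDiff ℝ ∞ φ) (ε : ℝ)
    (x : EuclideanSpace ℝ (Fin 3)) :
    fderiv ℝ (curl (fun y => v y + ε • φ y)) x = fderiv ℝ (curl v) x + ε • fderiv ℝ (curl φ) x := by
  rw [curl_add_smul (hv.differentiable (by simp)) (hφ.differentiable (by simp))]
  have h1 : ContDiff ℝ 1 (curl v) := contDiff_curl (n := 1) (hv.of_le (by norm_cast))
  have h2 : ContDiff ℝ 1 (curl φ) := contDiff_curl (n := 1) (hφ.of_le (by norm_cast))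
  exact fderiv_add_smul (h1.differentiable one_ne_zero) (h2.differentiable one_ne_zero) ε x

/-- `div (v + εφ) = div v + ε div φ`. [folklore] -/
theorem divergence_add_smul (hv : Differentiable ℝ v) (hφ : Differentiable ℝ φ) (ε : ℝ)
    (x : EuclideanSpace ℝ (Fin 3)) :
    VectorCalculus.divergence (fun y => v y + ε • φ y) x =
      VectorCalculus.divergence v x + ε * VectorCalculus.divergence φ x := by
  unfold VectorCalculus.divergence
  rw [fderiv_add_smul hv hφ, ContinuousLinearMap.toLinearMap_add, ContinuousLinearMap.toLinearMap_smul,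
    map_add, map_smul, smul_eq_mul]

/-- `Dᵏ(v + εφ) = Dᵏv + ε Dᵏφ` for smooth fields. [folklore] -/
theorem iteratedFDeriv_add_smul (hv : ContDiff ℝ ∞ v) (hφ : ContDiff ℝ ∞ φ) (ε : ℝ) (k : ℕ)
    (x : EuclideanSpace ℝ (Fin 3)) :
    iteratedFDeriv ℝ k (fun y => v y + ε • φ y) x = iteratedFDeriv ℝ k v x + ε • iteratedFDeriv ℝ k φ x := by
  have hv' : ContDiff ℝ k v := hv.of_le (by exact_mod_cast le_top)
  have hφ' : ContDiff ℝ k φ := hφ.of_le (by exact_mod_cast le_top)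
  have hεφ : ContDiff ℝ k (ε • φ) := hφ'.const_smul ε
  have h : (fun y => v y + ε • φ y) = v + ε • φ := rfl
  rw [h, iteratedFDeriv_add_apply hv'.contDiffAt hεφ.contDiffAt,
    iteratedFDeriv_const_smul_apply hφ'.contDiffAt]

/-! ## Pointwise polynomial expansions of the three densities -/

/-- The stretching density along the line: with `a = ω`, `b = curl φ`, `L = Dv`, `K = Dφ`,
`⟪a+εb, (L+εK)(a+εb)⟫ = ⟪a,La⟫ + ε(⟪b,La⟫+⟪a,Ka⟫+⟪a,Lb⟫) + ε²(⟪b,Ka⟫+⟪b,Lb⟫+⟪a,Kb⟫) + ε³⟪b,Kb⟫`. [folklore] -/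
theorem inner_apply_add_smul_expand (a b : EuclideanSpace ℝ (Fin 3))
    (L K : EuclideanSpace ℝ (Fin 3) →L[ℝ] EuclideanSpace ℝ (Fin 3)) (ε : ℝ) :
    ⟪a + ε • b, (L + ε • K) (a + ε • b)⟫ =
      ⟪a, L a⟫ + ε * (⟪b, L a⟫ + ⟪a, K a⟫ + ⟪a, L b⟫) +
        ε ^ 2 * (⟪b, K a⟫ + ⟪b, L b⟫ + ⟪a, K b⟫) + ε ^ 3 * ⟪b, K b⟫ := by
  simp only [FunLike.coe_add, FunLike.coe_smul, Pi.add_apply, Pi.smul_apply,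
    map_add, map_smul, inner_add_left, inner_add_right, inner_smul_left, inner_smul_right, RCLike.conj_to_real]
  ring

/-- `‖a + εb‖² = ‖a‖² + 2ε⟪a,b⟫ + ε²‖b‖²`. [folklore] -/
theorem norm_add_smul_sq_expand (a b : EuclideanSpace ℝ (Fin 3)) (ε : ℝ) :
    ‖a + ε • b‖ ^ 2 = ‖a‖ ^ 2 + 2 * ε * ⟪a, b⟫ + ε ^ 2 * ‖b‖ ^ 2 := by
  rw [norm_add_sq_real, norm_smul, inner_smul_right, Real.norm_eq_abs, mul_pow, sq_abs]
  ring

/-- `|L + εK|² = |L|² + 2ε Σᵢ⟪L eᵢ, K eᵢ⟫ + ε²|K|²` for the Frobenius norm. [folklore] -/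
theorem frobeniusNormSq_add_smul_expand (L K : EuclideanSpace ℝ (Fin 3) →L[ℝ] EuclideanSpace ℝ (Fin 3))
    (ε : ℝ) :
    frobeniusNormSq (L + ε • K) =
      frobeniusNormSq L + 2 * ε * (∑ i, ⟪L (EuclideanSpace.basisFun (Fin 3) ℝ i),
        K (EuclideanSpace.basisFun (Fin 3) ℝ i)⟫) + ε ^ 2 * frobeniusNormSq K := by
  rw [frobeniusNormSq_eq_sum (EuclideanSpace.basisFun (Fin 3) ℝ),
    frobeniusNormSq_eq_sum (EuclideanSpace.basisFun (Fin 3) ℝ),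
    frobeniusNormSq_eq_sum (EuclideanSpace.basisFun (Fin 3) ℝ)]
  simp only [FunLike.coe_add, FunLike.coe_smul, Pi.add_apply, Pi.smul_apply,
    norm_add_smul_sq_expand]
  rw [Finset.sum_add_distrib, Finset.sum_add_distrib, Finset.mul_sum, Finset.mul_sum]

/-! ## Supports: everything built from `φ` vanishes off `tsupport φ` (`tsupport_curl_subset` is the tree's) -/

/-- Off `tsupport φ`: `φ = 0`, `curl φ = 0`, `Dφ = 0`, `D(curl φ) = 0`. [folklore] -/
theorem vanish_of_notMem_tsupport {x : EuclideanSpace ℝ (Fin 3)} (hx : x ∉ tsupport φ) :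
    φ x = 0 ∧ curl φ x = 0 ∧ fderiv ℝ φ x = 0 ∧ fderiv ℝ (curl φ) x = 0 :=
  ⟨image_eq_zero_of_notMem_tsupport hx, curl_eq_zero_of_notMem_tsupport hx,
    fderiv_of_notMem_tsupport ℝ hx,
    fderiv_of_notMem_tsupport ℝ fun h => hx (tsupport_curl_subset φ h)⟩

/-- A continuous function vanishing off the compact `tsupport φ` is integrable. [folklore] -/
theorem integrable_of_vanish {G : Type*} [NormedAddCommGroup G] {f : EuclideanSpace ℝ (Fin 3) → G}
    (hφc : HasCompactSupport φ) (hf : Continuous f) (h0 : ∀ x, x ∉ tsupport φ → f x = 0) :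
    Integrable f (volume : Measure (EuclideanSpace ℝ (Fin 3))) :=
  hf.integrable_of_hasCompactSupport (HasCompactSupport.intro hφc h0)

/-! ## `L²` bookkeeping -/

/-- `∫⁻ ‖f‖ₑ² < ∞ ↔ ‖f‖_{L²} < ∞`. [folklore] -/
theorem lintegral_enorm_sq_lt_top_iff_eLpNorm {G : Type*} [NormedAddCommGroup G]
    {f : EuclideanSpace ℝ (Fin 3) → G} :
    ∫⁻ x, ‖f x‖ₑ ^ 2 < ⊤ ↔ eLpNorm f 2 (volume : Measure (EuclideanSpace ℝ (Fin 3))) < ⊤ := by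
  rw [eLpNorm_eq_lintegral_rpow_enorm_toReal two_ne_zero ENNReal.ofNat_ne_top, ENNReal.toReal_ofNat,
    ENNReal.rpow_lt_top_iff_of_pos (by norm_num : (0 : ℝ) < 1 / 2)]
  simp_rw [ENNReal.rpow_two]

/-- **`Dᵏ(v + εφ) ∈ L²`** when `Dᵏv ∈ L²` and `φ ∈ C^∞_c`. [folklore] -/
theorem lintegral_iteratedFDeriv_add_smul_lt_top (hv : ContDiff ℝ ∞ v) (hφ : ContDiff ℝ ∞ φ)
    (hφc : HasCompactSupport φ) (ε : ℝ) {k : ℕ} (hk : ∫⁻ x, ‖iteratedFDeriv ℝ k v x‖ₑ ^ 2 < ⊤) :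
    ∫⁻ x, ‖iteratedFDeriv ℝ k (fun y => v y + ε • φ y) x‖ₑ ^ 2 < ⊤ := by
  have hcv : Continuous (iteratedFDeriv ℝ k v) := hv.continuous_iteratedFDeriv (by exact_mod_cast le_top)
  have hcφ : Continuous (iteratedFDeriv ℝ k φ) := hφ.continuous_iteratedFDeriv (by exact_mod_cast le_top)
  have h1 : MemLp (iteratedFDeriv ℝ k v) 2 (volume : Measure (EuclideanSpace ℝ (Fin 3))) :=
    ⟨hcv.aestronglyMeasurable, lintegral_enorm_sq_lt_top_iff_eLpNorm.1 hk⟩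
  have h2 : MemLp (iteratedFDeriv ℝ k φ) 2 (volume : Measure (EuclideanSpace ℝ (Fin 3))) :=
    hcφ.memLp_of_hasCompactSupport (hφc.iteratedFDeriv (𝕜 := ℝ) k)
  have h3 : MemLp (fun x => iteratedFDeriv ℝ k v x + ε • iteratedFDeriv ℝ k φ x) 2
      (volume : Measure (EuclideanSpace ℝ (Fin 3))) := h1.add (h2.const_smul ε)
  have heq : (fun x => iteratedFDeriv ℝ k (fun y => v y + ε • φ y) x) =
      fun x => iteratedFDeriv ℝ k v x + ε • iteratedFDeriv ℝ k φ x :=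
    funext fun x => iteratedFDeriv_add_smul hv hφ ε k x
  rw [lintegral_enorm_sq_lt_top_iff_eLpNorm]
  change eLpNorm (fun x => iteratedFDeriv ℝ k (fun y => v y + ε • φ y) x) 2 volume < ⊤
  rw [heq]
  exact h3.2

/-! ## Admissibility of `v + εφ` -/

/-- **The perturbed field `v + εφ` is admissible** (apart from the sup bound, which depends on the
perturbation): smooth, divergence free, bounded gradient, `D⁰, D¹, D² ∈ L²`. [folklore] -/
theorem admissible_add_smul (hv : ContDiff ℝ ∞ v) (hdiv : VectorCalculus.IsDivFree v) {B : ℝ}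
    (hB : ∀ x, ‖fderiv ℝ v x‖ ≤ B) (h0 : ∫⁻ x, ‖iteratedFDeriv ℝ 0 v x‖ₑ ^ 2 < ⊤)
    (h1 : ∫⁻ x, ‖iteratedFDeriv ℝ 1 v x‖ₑ ^ 2 < ⊤) (h2 : ∫⁻ x, ‖iteratedFDeriv ℝ 2 v x‖ₑ ^ 2 < ⊤)
    (hφ : ContDiff ℝ ∞ φ) (hφc : HasCompactSupport φ) (hφdiv : VectorCalculus.IsDivFree φ) (ε : ℝ) :
    ContDiff ℝ ∞ (fun y => v y + ε • φ y) ∧ VectorCalculus.IsDivFree (fun y => v y + ε • φ y) ∧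
      (∃ B' : ℝ, ∀ x, ‖fderiv ℝ (fun y => v y + ε • φ y) x‖ ≤ B') ∧
      (∫⁻ x, ‖iteratedFDeriv ℝ 0 (fun y => v y + ε • φ y) x‖ₑ ^ 2 < ⊤) ∧
      (∫⁻ x, ‖iteratedFDeriv ℝ 1 (fun y => v y + ε • φ y) x‖ₑ ^ 2 < ⊤) ∧
      (∫⁻ x, ‖iteratedFDeriv ℝ 2 (fun y => v y + ε • φ y) x‖ₑ ^ 2 < ⊤) := by
  have hvd : Differentiable ℝ v := hv.differentiable (by simp)
  have hφd : Differentiable ℝ φ := hφ.differentiable (by simp)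
  obtain ⟨C, hC⟩ := (hφ.continuous_fderiv (by simp)).bounded_above_of_compact_support (hφc.fderiv (𝕜 := ℝ))
  refine ⟨hv.add (hφ.const_smul ε), fun x => ?_, ⟨B + |ε| * C, fun x => ?_⟩,
    lintegral_iteratedFDeriv_add_smul_lt_top hv hφ hφc ε h0,
    lintegral_iteratedFDeriv_add_smul_lt_top hv hφ hφc ε h1,
    lintegral_iteratedFDeriv_add_smul_lt_top hv hφ hφc ε h2⟩
  · rw [divergence_add_smul hvd hφd, hdiv x, hφdiv x, mul_zero, add_zero]
  · rw [fderiv_add_smul hvd hφd]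
    calc ‖fderiv ℝ v x + ε • fderiv ℝ φ x‖ ≤ ‖fderiv ℝ v x‖ + ‖ε • fderiv ℝ φ x‖ := norm_add_le _ _
      _ = ‖fderiv ℝ v x‖ + |ε| * ‖fderiv ℝ φ x‖ := by rw [norm_smul, Real.norm_eq_abs]
      _ ≤ B + |ε| * C := add_le_add (hB x) (mul_le_mul_of_nonneg_left (hC x) (abs_nonneg ε))

/-! ## Integrability of the densities and of the expansion coefficients -/

/-- `∫⁻ ‖f‖ₑ² < ∞` from integrability of `‖f‖²`. [folklore] -/
theorem lintegral_enorm_sq_lt_top_of_integrable_sq {G : Type*} [NormedAddCommGroup G]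
    {f : EuclideanSpace ℝ (Fin 3) → G}
    (hf : AEStronglyMeasurable f (volume : Measure (EuclideanSpace ℝ (Fin 3))))
    (hi : Integrable (fun x => ‖f x‖ ^ 2) (volume : Measure (EuclideanSpace ℝ (Fin 3)))) :
    ∫⁻ x, ‖f x‖ₑ ^ 2 < ⊤ :=
  lintegral_enorm_sq_lt_top_iff_eLpNorm.2 ((memLp_two_iff_integrable_sq_norm hf).2 hi).eLpNorm_lt_top

/-- `curl v ∈ L²` (as a Lebesgue integral) for an admissible field. [folklore] -/
theorem lintegral_enorm_curl_sq_lt_top (hv : ContDiff ℝ ∞ v) (h1 : ∫⁻ x, ‖iteratedFDeriv ℝ 1 v x‖ₑ ^ 2 < ⊤) :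
    ∫⁻ x, ‖curl v x‖ₑ ^ 2 < ⊤ :=
  lintegral_enorm_sq_lt_top_of_integrable_sq
    (continuous_curl (hv.of_le (by norm_cast))).aestronglyMeasurable
    (integrable_norm_curl_sq (hv.of_le (by norm_cast)) h1).1

/-- **The stretching density `⟪ω, Dv ω⟫` of an admissible field is integrable** (`|⟪ω, Dv ω⟫| ≤ B|ω|²`,
`ω ∈ L²`). [folklore] -/
theorem integrable_stretching (hv : ContDiff ℝ ∞ v) {B : ℝ} (hB : ∀ x, ‖fderiv ℝ v x‖ ≤ B)
    (h1 : ∫⁻ x, ‖iteratedFDeriv ℝ 1 v x‖ₑ ^ 2 < ⊤) :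
    Integrable (fun x => ⟪curl v x, fderiv ℝ v x (curl v x)⟫) (volume : Measure (EuclideanSpace ℝ (Fin 3))) := by
  have cω : Continuous (curl v) := continuous_curl (hv.of_le (by norm_cast))
  have l2ω := lintegral_enorm_curl_sq_lt_top hv h1
  refine integrable_of_norm_le_const_mul_mul B
    (cω.inner (((hv.continuous_fderiv (by simp))).clm_apply cω)) cω cω l2ω l2ω fun x => ?_
  calc ‖⟪curl v x, fderiv ℝ v x (curl v x)⟫‖ ≤ ‖curl v x‖ * ‖fderiv ℝ v x (curl v x)‖ :=
        norm_inner_le_norm _ _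
    _ ≤ ‖curl v x‖ * (B * ‖curl v x‖) :=
        mul_le_mul_of_nonneg_left ((fderiv ℝ v x).le_of_opNorm_le (hB x) _) (norm_nonneg _)
    _ = B * ‖curl v x‖ * ‖curl v x‖ := by ring

/-- The three mixed stretching coefficients along `v + εφ` are integrable (compact support). [folklore] -/
theorem integrable_stretching_coeffs (hv : ContDiff ℝ ∞ v) (hφ : ContDiff ℝ ∞ φ) (hφc : HasCompactSupport φ) :
    Integrable (fun x => ⟪curl φ x, fderiv ℝ v x (curl v x)⟫ + ⟪curl v x, fderiv ℝ φ x (curl v x)⟫ +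
        ⟪curl v x, fderiv ℝ v x (curl φ x)⟫) (volume : Measure (EuclideanSpace ℝ (Fin 3))) ∧
      Integrable (fun x => ⟪curl φ x, fderiv ℝ φ x (curl v x)⟫ + ⟪curl φ x, fderiv ℝ v x (curl φ x)⟫ +
        ⟪curl v x, fderiv ℝ φ x (curl φ x)⟫) (volume : Measure (EuclideanSpace ℝ (Fin 3))) ∧
      Integrable (fun x => ⟪curl φ x, fderiv ℝ φ x (curl φ x)⟫) (volume : Measure (EuclideanSpace ℝ (Fin 3))) := by
  have cω : Continuous (curl v) := continuous_curl (hv.of_le (by norm_cast))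
  have cψ : Continuous (curl φ) := continuous_curl (hφ.of_le (by norm_cast))
  have cDv : Continuous (fderiv ℝ v) := hv.continuous_fderiv (by simp)
  have cDφ : Continuous (fderiv ℝ φ) := hφ.continuous_fderiv (by simp)
  refine ⟨integrable_of_vanish hφc ?_ fun x hx => ?_, integrable_of_vanish hφc ?_ fun x hx => ?_,
    integrable_of_vanish hφc ?_ fun x hx => ?_⟩
  · exact ((cψ.inner (cDv.clm_apply cω)).add (cω.inner (cDφ.clm_apply cω))).add (cω.inner (cDv.clm_apply cψ))
  · obtain ⟨-, hc, hD, -⟩ := vanish_of_notMem_tsupport (φ := φ) hx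
    simp [hc, hD]
  · exact ((cψ.inner (cDφ.clm_apply cω)).add (cψ.inner (cDv.clm_apply cψ))).add (cω.inner (cDφ.clm_apply cψ))
  · obtain ⟨-, hc, hD, -⟩ := vanish_of_notMem_tsupport (φ := φ) hx
    simp [hc, hD]
  · exact cψ.inner (cDφ.clm_apply cψ)
  · obtain ⟨-, hc, hD, -⟩ := vanish_of_notMem_tsupport (φ := φ) hx
    simp [hc, hD]

/-- The enstrophy coefficients `⟪ω, curl φ⟫`, `‖curl φ‖²` along `v + εφ` are integrable. [folklore] -/
theorem integrable_enstrophy_coeffs (hv : ContDiff ℝ ∞ v) (hφ : ContDiff ℝ ∞ φ) (hφc : HasCompactSupport φ) :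
    Integrable (fun x => ⟪curl v x, curl φ x⟫) (volume : Measure (EuclideanSpace ℝ (Fin 3))) ∧
      Integrable (fun x => ‖curl φ x‖ ^ 2) (volume : Measure (EuclideanSpace ℝ (Fin 3))) := by
  have cω : Continuous (curl v) := continuous_curl (hv.of_le (by norm_cast))
  have cψ : Continuous (curl φ) := continuous_curl (hφ.of_le (by norm_cast))
  refine ⟨integrable_of_vanish hφc (cω.inner cψ) fun x hx => ?_,
    integrable_of_vanish hφc (cψ.norm.pow 2) fun x hx => ?_⟩
  · simp [(vanish_of_notMem_tsupport (φ := φ) hx).2.1]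
  · simp [(vanish_of_notMem_tsupport (φ := φ) hx).2.1]

/-- The palinstrophy coefficients `Σᵢ⟪∂ᵢω, ∂ᵢ curl φ⟫`, `|D curl φ|²` along `v + εφ` are integrable. [folklore] -/
theorem integrable_palinstrophy_coeffs (hv : ContDiff ℝ ∞ v) (hφ : ContDiff ℝ ∞ φ) (hφc : HasCompactSupport φ) :
    Integrable (fun x => ∑ i, ⟪fderiv ℝ (curl v) x (EuclideanSpace.basisFun (Fin 3) ℝ i),
        fderiv ℝ (curl φ) x (EuclideanSpace.basisFun (Fin 3) ℝ i)⟫)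
        (volume : Measure (EuclideanSpace ℝ (Fin 3))) ∧
      Integrable (fun x => frobeniusNormSq (fderiv ℝ (curl φ) x))
        (volume : Measure (EuclideanSpace ℝ (Fin 3))) := by
  have hω1 : ContDiff ℝ 1 (curl v) := contDiff_curl (n := 1) (hv.of_le (by norm_cast))
  have hψ1 : ContDiff ℝ 1 (curl φ) := contDiff_curl (n := 1) (hφ.of_le (by norm_cast))
  have cDω : Continuous (fderiv ℝ (curl v)) := hω1.continuous_fderiv one_ne_zero
  have cDψ : Continuous (fderiv ℝ (curl φ)) := hψ1.continuous_fderiv one_ne_zero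
  refine ⟨integrable_of_vanish hφc ?_ fun x hx => ?_, integrable_of_vanish hφc ?_ fun x hx => ?_⟩
  · exact continuous_finsetSum _ fun i _ =>
      (cDω.clm_apply continuous_const).inner (cDψ.clm_apply continuous_const)
  · simp [(vanish_of_notMem_tsupport (φ := φ) hx).2.2.2]
  · exact continuous_frobeniusNormSq_fderiv hψ1 one_ne_zero
  · simp [(vanish_of_notMem_tsupport (φ := φ) hx).2.2.2, frobeniusNormSq_zero]

/-! ## The three expansions along `v + εφ` -/

/-- **Expansion of the stretching integral**: `J(v+εφ) = J + εJ₁ + ε²J₂ + ε³J₃`. [folklore] -/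
theorem integral_stretching_add_smul (hv : ContDiff ℝ ∞ v) {B : ℝ} (hB : ∀ x, ‖fderiv ℝ v x‖ ≤ B)
    (h1 : ∫⁻ x, ‖iteratedFDeriv ℝ 1 v x‖ₑ ^ 2 < ⊤) (hφ : ContDiff ℝ ∞ φ) (hφc : HasCompactSupport φ)
    (ε : ℝ) :
    ∫ x, ⟪curl (fun y => v y + ε • φ y) x,
        fderiv ℝ (fun y => v y + ε • φ y) x (curl (fun y => v y + ε • φ y) x)⟫ =
      (∫ x, ⟪curl v x, fderiv ℝ v x (curl v x)⟫) +
        ε * (∫ x, (⟪curl φ x, fderiv ℝ v x (curl v x)⟫ + ⟪curl v x, fderiv ℝ φ x (curl v x)⟫ +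
          ⟪curl v x, fderiv ℝ v x (curl φ x)⟫)) +
        ε ^ 2 * (∫ x, (⟪curl φ x, fderiv ℝ φ x (curl v x)⟫ + ⟪curl φ x, fderiv ℝ v x (curl φ x)⟫ +
          ⟪curl v x, fderiv ℝ φ x (curl φ x)⟫)) +
        ε ^ 3 * (∫ x, ⟪curl φ x, fderiv ℝ φ x (curl φ x)⟫) := by
  have hvd : Differentiable ℝ v := hv.differentiable (by simp)
  have hφd : Differentiable ℝ φ := hφ.differentiable (by simp)
  have i0 := integrable_stretching hv hB h1
  obtain ⟨i1, i2, i3⟩ := integrable_stretching_coeffs hv hφ hφc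
  have hpt : ∀ x, ⟪curl (fun y => v y + ε • φ y) x,
      fderiv ℝ (fun y => v y + ε • φ y) x (curl (fun y => v y + ε • φ y) x)⟫ =
      ⟪curl v x, fderiv ℝ v x (curl v x)⟫ +
        ε * (⟪curl φ x, fderiv ℝ v x (curl v x)⟫ + ⟪curl v x, fderiv ℝ φ x (curl v x)⟫ +
          ⟪curl v x, fderiv ℝ v x (curl φ x)⟫) +
        ε ^ 2 * (⟪curl φ x, fderiv ℝ φ x (curl v x)⟫ + ⟪curl φ x, fderiv ℝ v x (curl φ x)⟫ +
          ⟪curl v x, fderiv ℝ φ x (curl φ x)⟫) +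
        ε ^ 3 * ⟪curl φ x, fderiv ℝ φ x (curl φ x)⟫ := by
    intro x
    rw [curl_add_smul hvd hφd, fderiv_add_smul hvd hφd]
    exact inner_apply_add_smul_expand _ _ _ _ ε
  rw [integral_congr_ae (Eventually.of_forall hpt), integral_add ?_ ?_, integral_add ?_ ?_,
    integral_add ?_ ?_, integral_const_mul, integral_const_mul, integral_const_mul]
  · exact i0
  · exact i1.const_mul ε
  · exact i0.add (i1.const_mul ε)
  · exact i2.const_mul _
  · exact (i0.add (i1.const_mul ε)).add (i2.const_mul _)
  · exact i3.const_mul _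

/-- **Expansion of the enstrophy**: `‖curl(v+εφ)‖₂² = Z + 2ε a₁ + ε² a₂`. [folklore] -/
theorem integral_normSq_curl_add_smul (hv : ContDiff ℝ ∞ v) (h1 : ∫⁻ x, ‖iteratedFDeriv ℝ 1 v x‖ₑ ^ 2 < ⊤)
    (hφ : ContDiff ℝ ∞ φ) (hφc : HasCompactSupport φ) (ε : ℝ) :
    ∫ x, ‖curl (fun y => v y + ε • φ y) x‖ ^ 2 =
      (∫ x, ‖curl v x‖ ^ 2) + 2 * ε * (∫ x, ⟪curl v x, curl φ x⟫) + ε ^ 2 * (∫ x, ‖curl φ x‖ ^ 2) := by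
  have hvd : Differentiable ℝ v := hv.differentiable (by simp)
  have hφd : Differentiable ℝ φ := hφ.differentiable (by simp)
  have i0 := (integrable_norm_curl_sq (hv.of_le (by norm_cast)) h1).1
  obtain ⟨i1, i2⟩ := integrable_enstrophy_coeffs hv hφ hφc
  have hpt : ∀ x, ‖curl (fun y => v y + ε • φ y) x‖ ^ 2 =
      ‖curl v x‖ ^ 2 + 2 * ε * ⟪curl v x, curl φ x⟫ + ε ^ 2 * ‖curl φ x‖ ^ 2 := by
    intro x
    rw [curl_add_smul hvd hφd]
    exact norm_add_smul_sq_expand _ _ ε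
  rw [integral_congr_ae (Eventually.of_forall hpt), integral_add ?_ ?_, integral_add ?_ ?_,
    integral_const_mul, integral_const_mul]
  · exact i0
  · exact i1.const_mul _
  · exact i0.add (i1.const_mul _)
  · exact i2.const_mul _

/-- **Expansion of the palinstrophy**: `‖∇curl(v+εφ)‖₂² = W + 2ε c₁ + ε² c₂`. [folklore] -/
theorem integral_frobeniusNormSq_add_smul (hv : ContDiff ℝ ∞ v) (h2 : ∫⁻ x, ‖iteratedFDeriv ℝ 2 v x‖ₑ ^ 2 < ⊤)
    (hφ : ContDiff ℝ ∞ φ) (hφc : HasCompactSupport φ) (ε : ℝ) :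
    ∫ x, frobeniusNormSq (fderiv ℝ (curl (fun y => v y + ε • φ y)) x) =
      (∫ x, frobeniusNormSq (fderiv ℝ (curl v) x)) +
        2 * ε * (∫ x, ∑ i, ⟪fderiv ℝ (curl v) x (EuclideanSpace.basisFun (Fin 3) ℝ i),
          fderiv ℝ (curl φ) x (EuclideanSpace.basisFun (Fin 3) ℝ i)⟫) +
        ε ^ 2 * (∫ x, frobeniusNormSq (fderiv ℝ (curl φ) x)) := by
  have i0 := (integrable_frobeniusNormSq_fderiv_curl (hv.of_le (by norm_cast)) h2).1
  obtain ⟨i1, i2⟩ := integrable_palinstrophy_coeffs hv hφ hφc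
  have hpt : ∀ x, frobeniusNormSq (fderiv ℝ (curl (fun y => v y + ε • φ y)) x) =
      frobeniusNormSq (fderiv ℝ (curl v) x) +
        2 * ε * (∑ i, ⟪fderiv ℝ (curl v) x (EuclideanSpace.basisFun (Fin 3) ℝ i),
          fderiv ℝ (curl φ) x (EuclideanSpace.basisFun (Fin 3) ℝ i)⟫) +
        ε ^ 2 * frobeniusNormSq (fderiv ℝ (curl φ) x) := by
    intro x
    rw [fderiv_curl_add_smul hv hφ]
    exact frobeniusNormSq_add_smul_expand _ _ ε
  rw [integral_congr_ae (Eventually.of_forall hpt), integral_add ?_ ?_, integral_add ?_ ?_,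
    integral_const_mul, integral_const_mul]
  · exact i0
  · exact i1.const_mul _
  · exact i0.add (i1.const_mul _)
  · exact i2.const_mul _

end DepletionLadder.KStar

end Summit.NavierStokesRegularity.NavierStokesRegularity.Theorems

end
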